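import Summits.KontsevichZagierPeriods.Zeta5Search.WedgeDictionaryLevelDescentStep
import Summits.KontsevichZagierPeriods.Zeta5Search.WedgeDictionaryLevelDescentFaceExt
import HarnessLib

/-!
# Level descent (LD@N) — S4: the base case on the extended face `b₁ + b₂ = N`, modulo the face value of `U` — PROVED

HONEST FRAMING: systematic search; no irrationality claim unless certified.

gen-1 g7 (planner-pub-zeta5-gen-1-g7-0). Step S4 of the assembly plan (memo `HOME/pub-zeta5-gen-1/D2-LD-PROOF-g7.md` §9): on the hyperplane
`c₁₂ = 0` the m-indexed level-descent identities `ldBoxW` / `ldBoxV` (file `…LevelDescentStep`) reduce to the VALUE of `U(b)` there: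
* wedge side (`ldFaceWedge_holds`, file `…LevelDescentFaceExt`): `casUW b = U(b)·W(b♭)`, `casUV b = U(b)·V(b♭)`;
* weight side (`ldW_face`, file `…LevelDescentWeightsProof`): `ldSum X b = [ldSupp b b₇]·faceValue b · X(degShape b 0)` and `degShape b 0 = b♭`
  (`degShape_zero`), with `faceSupp b ↔ ldSupp b b₇` on the face (`faceSupp_iff_ldSupp`);
so `coeffU_faceExt_stmt` (`U(b) = [faceSupp b]·faceValue b`, OPEN, INTERNALLY MINTED; P1's `coeffU_face_closed` is the case `b₁ = b₂`)
implies the base case for `N ≥ 1`: `ldFaceBaseW_holds`, `ldFaceBaseV_holds` — stated on the EXTENDED region (slots in `[0, N]`, `d ≥ 0`; no balance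
  condition on the triple `b₁, b₂, b₇`, because the induction's hypotheses leave the balanced box and reach the face with `b₁ ≠ b₂`).

What this is NOT: a proof of `coeffU_faceExt_stmt`; the level `N = 0` (the single shape `b = 0`, where `levelDescent_faceExt` does not apply —
checked exactly, to be discharged separately); the induction S5; anything about irrationality.
-/

open Finset

namespace Summit.KontsevichZagierPeriods.Zeta5Search.WedgeDictionary

open Summit.KontsevichZagierPeriods.Zeta5Search.DualSeries

/-- `degShape b 0 = b♭`. -/
theorem degShape_zero (b : ℕ → ℤ) : degShape b 0 = LevelDescent.faceShape b := by
  funext s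
  rw [LevelDescent.faceShape_apply]
  unfold degShape
  by_cases h1 : s = 1
  · subst h1; simp
  · by_cases h2 : s = 2
    · subst h2; simp
    · by_cases h7 : s = 7
      · subst h7; simp
      · simp [h1, h2, h7]

/-- On the face `b₁ + b₂ = N` (with `b₇ ≥ 0`): `faceSupp b ↔ ldSupp b b₇`. -/
theorem faceSupp_iff_ldSupp (b : ℕ → ℤ) (h12 : b 1 + b 2 = b 0) (h7 : 0 ≤ b 7) : faceSupp b ↔ ldSupp b (b 7) := by
  have e36 : (Icc 3 6 : Finset ℕ) = {3, 4, 5, 6} := by decide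
  have e37 : (Icc 3 7 : Finset ℕ) = {3, 4, 5, 6, 7} := by decide
  unfold faceSupp ldSupp sigmaT
  rw [e36, e37]
  simp only [mem_insert, mem_singleton, forall_eq_or_imp, forall_eq]
  omega

/-- Slots in `[0, N]` give `InBox`. -/
theorem inBox_of_slots (b : ℕ → ℤ) (h0 : 0 ≤ b 0) (hS : ∀ j ∈ Icc 1 7, 0 ≤ b j ∧ b j ≤ b 0) : InBox b := by
  refine ⟨h0, fun j hj => ?_⟩
  have := hS (j + 1) (mem_Icc.2 ⟨by omega, by have := mem_range.1 hj; omega⟩)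
  omega

/-- The weight side on the face: `ldSum X b = [ldSupp b b₇]·faceValue b · X(b♭)`. -/
theorem ldSum_face (X : (ℕ → ℤ) → ℚ) (b : ℕ → ℤ) (h0 : 0 ≤ b 0) (hS : ∀ j ∈ Icc 1 7, 0 ≤ b j ∧ b j ≤ b 0)
    (hd : 0 ≤ dOf b) (h12 : b 1 + b 2 = b 0) :
    ldSum X b = (if ldSupp b (b 7) then faceValue b else 0) * X (LevelDescent.faceShape b) := by
  have h7 := hS 7 (by simp)
  unfold ldSum
  rw [sum_eq_single (b 7)]
  · rw [ldW_face b (b 7) h0 hS hd h12, sub_self, degShape_zero]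
    simp
  · intro m _ hne
    rw [ldW_face b m h0 hS hd h12, if_neg (fun hh => hne hh.1), zero_mul]
  · intro hh
    exfalso
    exact hh (mem_Icc.2 ⟨h7.1, h7.2⟩)

/-- STATEMENT (S4/W, PROVED below as `ldFaceBaseW_holds`): the face value of `U` implies the base case of `ldBoxW` on `b₁ + b₂ = N ≥ 1`. -/
def ldFaceBaseW_stmt : Prop :=
  coeffU_faceExt_stmt → ∀ b : ℕ → ℤ, 1 ≤ b 0 → (∀ j ∈ Icc 1 7, 0 ≤ b j ∧ b j ≤ b 0) → 0 ≤ dOf b → b 1 + b 2 = b 0 →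
    casUW b = ldSum coeffW b

/-- STATEMENT (S4/V, PROVED below as `ldFaceBaseV_holds`): the same for `ldBoxV` (its extra hypothesis `c₁₂ ≤ b₇` is void on the face). -/
def ldFaceBaseV_stmt : Prop :=
  coeffU_faceExt_stmt → ∀ b : ℕ → ℤ, 1 ≤ b 0 → (∀ j ∈ Icc 1 7, 0 ≤ b j ∧ b j ≤ b 0) → 0 ≤ dOf b → b 1 + b 2 = b 0 →
    casUV b = ldSum coeffV b

/-- **S4/W PROVED.** -/
theorem ldFaceBaseW_holds : ldFaceBaseW_stmt := by
  intro hU b hN1 hS hd h12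
  have h0 : 0 ≤ b 0 := by omega
  have h7 := hS 7 (by simp)
  obtain ⟨-, hW, -⟩ := ldFaceWedge_holds b (inBox_of_slots b h0 hS) h12 hN1 hd h7.2
  have e7 : Function.update b 7 (b 7 + 1) = bump b 6 := by simp only [bump, Nat.reduceAdd]
  rw [e7] at hW
  have cW : casUW b = coeffU b * coeffW (LevelDescent.faceShape b) := by unfold casUW; exact hW
  rw [cW, ldSum_face coeffW b h0 hS hd h12, hU b h0 hS hd h12]
  simp [faceSupp_iff_ldSupp b h12 h7.1]

/-- **S4/V PROVED.** -/
theorem ldFaceBaseV_holds : ldFaceBaseV_stmt := by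
  intro hU b hN1 hS hd h12
  have h0 : 0 ≤ b 0 := by omega
  have h7 := hS 7 (by simp)
  obtain ⟨-, -, hV⟩ := ldFaceWedge_holds b (inBox_of_slots b h0 hS) h12 hN1 hd h7.2
  have e7 : Function.update b 7 (b 7 + 1) = bump b 6 := by simp only [bump, Nat.reduceAdd]
  rw [e7] at hV
  have cV : casUV b = coeffU b * coeffV (LevelDescent.faceShape b) := by unfold casUV; exact hV
  rw [cV, ldSum_face coeffV b h0 hS hd h12, hU b h0 hS hd h12]
  simp [faceSupp_iff_ldSupp b h12 h7.1]

end Summit.KontsevichZagierPeriods.Zeta5Search.WedgeDictionary
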